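import Summits.Ventures.Crystal3D.Theorems.StickyWulffConstantTextureLiminfTexShadowLevelReachFourFamilyOneLetter
import Summits.Ventures.Crystal3D.Theorems.StickyWulffConstantTextureLiminfTexShadowLevelReachCoSlot
import Summits.Ventures.Crystal3D.Theorems.StickyWulffConstantGenericWallFloorHStarSingle
import Summits.Ventures.Crystal3D.Theorems.StickyWulffConstantGenericWallFloorGrainCredits
import Summits.Ventures.Crystal3D.Theorems.StickyWulffConstantCoaxialWallLawTwinFrames
import HarnessLib

/-!
# The one-letter lamella frame is NOT a frame of its own plate: `hneA` discharged against the NEAR plate (reduced-word rigidity, words `[μ]` and `[μ, e₃]`)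
# (lane T, crux `TextureLiminfV5`, stmt-Ventures-23912, registered stub `stub_terraceCensus`; (β) assembly RESUME (d)/(d′) — hypotheses of the born censuses)

HONEST FRAMING. Venture `Summits/Ventures/Crystal3D` (cell `crystal3d-full`), route `route-Ventures-StickyWulffConstant`, helper `--supports` the law-v5
crux `TextureLiminfV5` (stmt-Ventures-23912), lane T, mechanism (β).  Pure frame algebra over lane F's reduced-word rigidity
(`image_fccSlots_ne_wordFrame_of_ne_nil`, …LevelReachCoSlot); census-free, certificate-free; nothing about energies; F-C1 not moved.

THE POINT.  The born censuses / supply census of the plate-adjacent lamella (`born_barlow_endPairs`, `inner_trackable_le_census`, …) take the hypotheses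
«the launch dozen `A = M_μ ≫ Fr` is neither of a plate's two dozens `L`, `bM ≫ L`».  Against the plate the lamella sits on (`Fr ∈ {L₁, bM ≫ L₁}`, `μ` a
unit model menu normal crossed by a basal root: `⟪r, μ⟫ ≠ 0`) both are theorems:
* `inner_e₃_eq_third_or_of_crossed` — such a `μ` is oblique to the basal plane: `⟪μ, e₃⟫ = ±1/3` (a unit slot reflected in `μ` has height `∓2⟪r,μ⟫μ₂`
  of modulus `≤ 1`, so `|μ₂| < 1`, and `μ₂ ∈ {±1, ±1/3}` by `modelNormal_apply_two`);
* `basalMirror_eq_reflection_e₃` — lane F's cell mirror is the model mirror `M_{e₃}`;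
* `oneLetter_dozen_ne` / `oneLetter_dozen_ne_basalMirror` — `(M_μ ≫ B)`-dozen ≠ `B`-dozen (word `[μ]`) and ≠ `(bM ≫ B)`-dozen (word `[μ, e₃]` over the
  base `bM ≫ B`);
* **`oneLetter_dozens_ne_plate`** — for `Fr` of type `t` over `L₁` (`hFr`): `(M_μ ≫ Fr)`-dozen ≠ `L₁`-dozen and ≠ `(bM ≫ L₁)`-dozen — the `hneA₁/hneA₁'`
  (rising family, vs the bottom plate) and, with `G₂` over `L₂`, the `hneA₂/hneA₂'` of the falling family vs the top plate.
The inequalities against the FAR plate depend on the relating word (assembly data) and are not discharged here.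
WHAT THIS IS NOT: any census, any certificate; F-C1 not moved.
-/

noncomputable section

namespace Summit.Ventures.Crystal3D.Theorems

open Summit.Ventures.Crystal3D Finset
open Literature.MathematicalPhysics.StatisticalMechanics (basalMirror)
open Summit.Ventures.Crystal3D.Cruxes.TextureLiminf.TexShadow (E3)
open scoped InnerProductSpace

/-- A unit model menu normal crossed by a BASAL slot is oblique to the basal plane: `⟪μ, e₃⟫ = ±1/3`. -/
theorem inner_e₃_eq_third_or_of_crossed {r μ : E3} (hr : r ∈ basalHexagon) (hμ1 : ‖μ‖ = 1)
    (hμmenu : ∀ w ∈ fccSlots, ⟪w, μ⟫_ℝ = 0 ∨ ⟪w, μ⟫_ℝ = Real.sqrt (2 / 3) ∨ ⟪w, μ⟫_ℝ = -Real.sqrt (2 / 3))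
    (hcross : ⟪r, μ⟫_ℝ ≠ 0) :
    ⟪μ, EuclideanSpace.single (2 : Fin 3) (1 : ℝ)⟫_ℝ = 1 / 3 ∨ ⟪μ, EuclideanSpace.single (2 : Fin 3) (1 : ℝ)⟫_ℝ = -1 / 3 := by
  have hrS : r ∈ fccSlots := (mem_filter.1 hr).1
  have hr2 : r 2 = 0 := (mem_filter.1 hr).2
  have hs : 0 < Real.sqrt (2 / 3) := Real.sqrt_pos.2 (by norm_num)
  have hs2 : Real.sqrt (2 / 3) ^ 2 = 2 / 3 := Real.sq_sqrt (by norm_num)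
  -- the reflected slot is a unit vector, so its height is at most `1` in modulus
  have hnorm : ‖(ℝ ∙ μ)ᗮ.reflection r‖ = 1 := by rw [LinearIsometryEquiv.norm_map, norm_eq_one_of_mem_fccSlots hrS]
  have hcoord : |((ℝ ∙ μ)ᗮ.reflection r) 2| ≤ 1 := by
    have := abs_sub_apply_le_dist' ((ℝ ∙ μ)ᗮ.reflection r) 0 2
    rw [PiLp.zero_apply, sub_zero, dist_zero_right, hnorm] at this
    exact this
  rw [reflection_unit_apply hμ1, PiLp.sub_apply, PiLp.smul_apply, smul_eq_mul, hr2, zero_sub, abs_neg, abs_mul, abs_mul] at hcoord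
  have habs : |⟪r, μ⟫_ℝ| = Real.sqrt (2 / 3) := by
    rcases hμmenu r hrS with h0 | h0 | h0
    · exact absurd h0 hcross
    · rw [h0, abs_of_pos hs]
    · rw [h0, abs_neg, abs_of_pos hs]
  rw [habs, show |(2 : ℝ)| = 2 by norm_num] at hcoord
  have hlt : |μ 2| < 1 := by nlinarith [hcoord, hs2, abs_nonneg (μ 2)]
  have hμ2 := modelNormal_apply_two (mem_modelNormals_of_menu hμ1 hμmenu)
  rw [← apply_two_eq_inner_e₃]
  rcases hμ2 with h | h | h | h
  · rw [h, abs_one] at hlt; exact absurd hlt (lt_irrefl _)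
  · rw [h, abs_neg, abs_one] at hlt; exact absurd hlt (lt_irrefl _)
  · exact Or.inl h
  · right; rw [h]; ring

/-- Lane F's basal mirror is the model mirror in the basal plane, `M_{e₃} = (ℝ ∙ e₃)ᗮ.reflection`. -/
theorem basalMirror_eq_reflection_e₃ :
    basalMirror = (ℝ ∙ (EuclideanSpace.single (2 : Fin 3) (1 : ℝ) : E3))ᗮ.reflection := by
  have he : ‖(EuclideanSpace.single (2 : Fin 3) (1 : ℝ) : E3)‖ = 1 := by rw [PiLp.norm_single, norm_one]
  refine LinearIsometryEquiv.ext fun w => ?_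
  rw [basalMirror_eq_sub_smul, reflection_unit_apply he, ← apply_two_eq_inner_e₃]

/-- `e₃` is a unit model menu normal. -/
theorem e₃_unit_menu : ‖(EuclideanSpace.single (2 : Fin 3) (1 : ℝ) : E3)‖ = 1 ∧
    ∀ w ∈ fccSlots, ⟪w, (EuclideanSpace.single (2 : Fin 3) (1 : ℝ) : E3)⟫_ℝ = 0 ∨
      ⟪w, (EuclideanSpace.single (2 : Fin 3) (1 : ℝ) : E3)⟫_ℝ = Real.sqrt (2 / 3) ∨
      ⟪w, (EuclideanSpace.single (2 : Fin 3) (1 : ℝ) : E3)⟫_ℝ = -Real.sqrt (2 / 3) := by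
  refine ⟨by rw [PiLp.norm_single, norm_one], fun w hw => ?_⟩
  rw [← apply_two_eq_inner_e₃]
  exact slot_apply_two_cases hw

/-- **One letter changes the dozen**: `(M_μ ≫ B)`-dozen ≠ `B`-dozen. -/
theorem oneLetter_dozen_ne (B : E3 ≃ₗᵢ[ℝ] E3) {μ : E3} (hμ1 : ‖μ‖ = 1)
    (hμmenu : ∀ w ∈ fccSlots, ⟪w, μ⟫_ℝ = 0 ∨ ⟪w, μ⟫_ℝ = Real.sqrt (2 / 3) ∨ ⟪w, μ⟫_ℝ = -Real.sqrt (2 / 3)) :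
    ((((ℝ ∙ μ)ᗮ.reflection).trans B : E3 ≃ₗᵢ[ℝ] E3) : E3 → E3) '' ↑fccSlots ≠ (B : E3 → E3) '' ↑fccSlots := by
  have h := image_fccSlots_ne_wordFrame_of_ne_nil B (w₀ := [μ]) (fun ν hν => by rw [List.mem_singleton.1 hν]; exact ⟨hμ1, hμmenu⟩)
    (List.isChain_singleton μ) (List.cons_ne_nil μ [])
  rw [wordFrame_cons] at h
  exact fun e => h e.symm

/-- **One letter is not the basal twin**: `(M_μ ≫ B)`-dozen ≠ `(bM ≫ B)`-dozen for `μ` oblique to the basal plane (`⟪μ, e₃⟫ = ±1/3`) — the reduced word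
`[μ, e₃]` over the base `bM ≫ B`. -/
theorem oneLetter_dozen_ne_basalMirror (B : E3 ≃ₗᵢ[ℝ] E3) {μ : E3} (hμ1 : ‖μ‖ = 1)
    (hμmenu : ∀ w ∈ fccSlots, ⟪w, μ⟫_ℝ = 0 ∨ ⟪w, μ⟫_ℝ = Real.sqrt (2 / 3) ∨ ⟪w, μ⟫_ℝ = -Real.sqrt (2 / 3))
    (hμe : ⟪μ, EuclideanSpace.single (2 : Fin 3) (1 : ℝ)⟫_ℝ = 1 / 3 ∨ ⟪μ, EuclideanSpace.single (2 : Fin 3) (1 : ℝ)⟫_ℝ = -1 / 3) :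
    ((((ℝ ∙ μ)ᗮ.reflection).trans B : E3 ≃ₗᵢ[ℝ] E3) : E3 → E3) '' ↑fccSlots ≠
      ((basalMirror.trans B : E3 ≃ₗᵢ[ℝ] E3) : E3 → E3) '' ↑fccSlots := by
  set e₃ : E3 := EuclideanSpace.single (2 : Fin 3) (1 : ℝ) with he₃
  have hl : ∀ ν ∈ [μ, e₃], ‖ν‖ = 1 ∧ ∀ w ∈ fccSlots, ⟪w, ν⟫_ℝ = 0 ∨ ⟪w, ν⟫_ℝ = Real.sqrt (2 / 3) ∨ ⟪w, ν⟫_ℝ = -Real.sqrt (2 / 3) := by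
    intro ν hν
    rcases List.mem_cons.1 hν with rfl | hν
    · exact ⟨hμ1, hμmenu⟩
    · rw [List.mem_singleton.1 hν]; exact e₃_unit_menu
  have hc : List.IsChain (fun ν ν' : E3 => ⟪ν, ν'⟫_ℝ = 1 / 3 ∨ ⟪ν, ν'⟫_ℝ = -1 / 3) [μ, e₃] :=
    List.IsChain.cons_cons hμe (List.isChain_singleton _)
  have h := image_fccSlots_ne_wordFrame_of_ne_nil (basalMirror.trans B) (w₀ := [μ, e₃]) hl hc (List.cons_ne_nil _ _)
  -- `wordFrame (bM ≫ B) [μ, e₃] = M_μ ≫ (M_{e₃} ≫ (bM ≫ B)) = M_μ ≫ B`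
  have hw : wordFrame (basalMirror.trans B) [μ, e₃] = ((ℝ ∙ μ)ᗮ.reflection).trans B := by
    rw [wordFrame_cons, wordFrame_cons]
    show ((ℝ ∙ μ)ᗮ.reflection).trans (((ℝ ∙ e₃)ᗮ.reflection).trans (basalMirror.trans B)) = ((ℝ ∙ μ)ᗮ.reflection).trans B
    rw [he₃, ← basalMirror_eq_reflection_e₃, LinearIsometryEquiv.trans_assoc basalMirror basalMirror B,
      basalMirror_eq_reflection_e₃, Submodule.reflection_trans_reflection, LinearIsometryEquiv.refl_trans]
  rw [hw] at h
  exact fun e => h e.symm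

/-- **The one-letter lamella frame is not a frame of its own plate.**  `Fr` a frame of type `t` over `L₁` (`Fr = L₁` or `bM ≫ L₁`), `μ` a unit model menu
normal crossed by a basal slot `r`: the dozen of `M_μ ≫ Fr` is neither `L₁`'s nor `(bM ≫ L₁)`'s — the `hneA` hypotheses of the born censuses against the
NEAR plate. -/
theorem oneLetter_dozens_ne_plate (L₁ Fr : E3 ≃ₗᵢ[ℝ] E3) {t : ℤ} (hFr : (t = 1 ∧ Fr = L₁) ∨ (t = -1 ∧ Fr = basalMirror.trans L₁))
    {r μ : E3} (hr : r ∈ basalHexagon) (hμ1 : ‖μ‖ = 1)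
    (hμmenu : ∀ w ∈ fccSlots, ⟪w, μ⟫_ℝ = 0 ∨ ⟪w, μ⟫_ℝ = Real.sqrt (2 / 3) ∨ ⟪w, μ⟫_ℝ = -Real.sqrt (2 / 3))
    (hcross : ⟪r, μ⟫_ℝ ≠ 0) :
    ((((ℝ ∙ μ)ᗮ.reflection).trans Fr : E3 ≃ₗᵢ[ℝ] E3) : E3 → E3) '' ↑fccSlots ≠ (L₁ : E3 → E3) '' ↑fccSlots ∧
    ((((ℝ ∙ μ)ᗮ.reflection).trans Fr : E3 ≃ₗᵢ[ℝ] E3) : E3 → E3) '' ↑fccSlots ≠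
      ((basalMirror.trans L₁ : E3 ≃ₗᵢ[ℝ] E3) : E3 → E3) '' ↑fccSlots := by
  have hμe := inner_e₃_eq_third_or_of_crossed hr hμ1 hμmenu hcross
  have h1 := oneLetter_dozen_ne Fr hμ1 hμmenu
  have h2 := oneLetter_dozen_ne_basalMirror Fr hμ1 hμmenu hμe
  have hbb : basalMirror.trans (basalMirror.trans L₁) = L₁ := by
    rw [LinearIsometryEquiv.trans_assoc, basalMirror_eq_reflection_e₃, Submodule.reflection_trans_reflection,
      LinearIsometryEquiv.refl_trans]
  rcases hFr with ⟨-, rfl⟩ | ⟨-, rfl⟩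
  · exact ⟨h1, h2⟩
  · rw [hbb] at h2
    exact ⟨h2, h1⟩

end Summit.Ventures.Crystal3D.Theorems

end
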